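import Summits.FinalStateConjecture.FinalStateConjecture.Theorems.BartnikGapSettlingBondiBartnikRigiditySlabFrontier
import Literature.Geometry.Lorentzian.CausalFutureProofs
import Literature.Geometry.Lorentzian.CausalityOpennessProofs
import Literature.Geometry.Lorentzian.KerrSchildTimeTranslation
import Literature.Geometry.Lorentzian.MinkowskiGlobalHyperbolicity
import HarnessLib

/-!
# K2b-5 `stub_marchingLemma`, brick 7: stationarity of the causal future of the slab — line
# `direct-method-on-the-cone` (crux `BondiBartnikRigidity`, stmt-FinalStateConjecture-10807)

Kerr-side set geometry of the open causal future `W = J⁺_K(slab)°` of the thick slab in the star chart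
`Kerr.spacetime M a M` (`0 < M`, `|a| < M`) consumed by the marching (report K2b-a2 §4: "using
`J⁺_K(slab)° + s e₀ ⊆ J⁺_K(slab)°` from the cylinder fact + `t*`-translation isometry"):

* `isFutureCausalCurveOn_translate`, `isFutureTimelikeCurveOn_translate` — the `t*`-translate
  `γ + c ∂_{t*}` of a future causal/timelike curve of the chart is one (the Kerr–Schild components and the
  orientation `−g♯dt*` do not depend on `t*`); hence `mem_JK_translate_iff`, `mem_IK_translate_iff`:
  `J⁺_K(S + c e₀) = J⁺_K(S) + c e₀`, the same for `I⁺_K`;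
* `JK_slabK_translate_subset`, `interior_JK_slabK_translate_subset` — for `s ≥ 0`,
  `J⁺_K(slab) + s e₀ ⊆ J⁺_K(slab)` and `W + s e₀ ⊆ W` (the translated slab lies in the solid cylinder,
  `K2Route.SlabFutureContainsCylinder`, then transitivity of `J⁺`);
* `chronologicalFuture_subset_interior_JK` — `W` is a future set: `I⁺_K(x) ⊆ W` for `x ∈ W`;
* `isClosed_JK_slabK` — `J⁺_K(slab)` is closed (`K2Route.SlabFrontier`); `interior_JK_slabK_pos` —
  `W ⊆ {t* > 0}`.

References: Dafermos–Rodnianski arXiv:0811.0354, §5.1 [DafermosRodnianski2008]; O'Neill 1983, Ch. 9,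
pp. 255–256, Ch. 14, p. 402 [ONeill1983]; Hawking–Ellis 1973, §6.3 [HawkingEllis1973CUP].
No definitions, no named facts.
-/

noncomputable section

-- D-0017: single-problem summit, `Summit.<S>.<S>.…` by design (cf. lakefile `weak.linter.dupNamespace`).
set_option linter.dupNamespace false
set_option maxSynthPendingDepth 3

open Set Filter Function Topology TopologicalSpace
open Literature.Geometry.Lorentzian
open scoped Manifold ContDiff Topology
open Summit.FinalStateConjecture.FinalStateConjecture.Theorems.SwallowTheDatum.KerrShieldedSettles.CollarCauchy
  (velocity_eq_deriv)

namespace Summit.FinalStateConjecture.FinalStateConjecture.Theorems.BondiBartnikRigidity.DirectMethod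

namespace FutureK

variable [Kerr.Facts] {M a : ℝ}

/-! ### Translates of causal and timelike curves -/

omit [Kerr.Facts] in
/-- The `t*`-translate of a point of the chart. [folklore] -/
theorem translate_mem_region (y : Kerr.region a M) (c : ℝ) :
    (y : E4) + c • E4.basisVector 0 ∈ Kerr.region a M :=
  Kerr.add_smul_basisVector_zero_mem_region y.2 c

/-- **The `t*`-translate of a future causal curve of the chart is a future causal curve** (same velocity;
the components `g_{M,a}` and the orientation `V` are `t*`-invariant). [cite: ONeill1983, Ch. 9, pp. 255–256] -/
theorem isFutureCausalCurveOn_translate {hM : 0 ≤ M} {γ : ℝ → Kerr.region a M} {s : Set ℝ}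
    (hγ : (Kerr.smoothMetric M a M).IsFutureCausalCurveOn ((Kerr.timeOrientation M a M hM).ofLE le_top) γ s)
    (c : ℝ) :
    (Kerr.smoothMetric M a M).IsFutureCausalCurveOn ((Kerr.timeOrientation M a M hM).ofLE le_top)
      (fun t => (⟨(γ t : E4) + c • E4.basisVector 0, translate_mem_region (γ t) c⟩ : Kerr.region a M)) s := by
  intro t ht
  obtain ⟨hd, ⟨hc, hne⟩, hfd⟩ := hγ t ht
  set γ' : ℝ → Kerr.region a M := fun t => ⟨(γ t : E4) + c • E4.basisVector 0, translate_mem_region (γ t) c⟩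
  have hdE : DifferentiableAt ℝ (fun σ => (γ σ : E4)) t :=
    mdifferentiableAt_iff_differentiableAt.mp
      ((mdifferentiableAt_subtypeVal_comp_curve_iff (I := 𝓘(ℝ, E4)) (Kerr.region a M)).2 hd)
  have hdE' : DifferentiableAt ℝ (fun σ => (γ' σ : E4)) t := hdE.add_const _
  have hd' : MDifferentiableAt 𝓘(ℝ, ℝ) 𝓘(ℝ, E4) γ' t :=
    (mdifferentiableAt_subtypeVal_comp_curve_iff (I := 𝓘(ℝ, E4)) (Kerr.region a M)).1
      (mdifferentiableAt_iff_differentiableAt.mpr hdE')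
  have hvel : (velocity 𝓘(ℝ, E4) γ' t : E4) = (velocity 𝓘(ℝ, E4) γ t : E4) := by
    rw [velocity_eq_deriv, velocity_eq_deriv]
    show deriv (fun σ => (γ σ : E4) + c • E4.basisVector 0) t = deriv (fun σ => (γ σ : E4)) t
    exact deriv_add_const _
  have hbase : (γ' t : E4) = (γ t : E4) + c • E4.basisVector 0 := rfl
  refine ⟨hd', ⟨?_, ?_⟩, ?_⟩
  · show Kerr.bilin M a (γ' t : E4) (velocity 𝓘(ℝ, E4) γ' t) (velocity 𝓘(ℝ, E4) γ' t) ≤ 0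
    rw [hvel, hbase, Kerr.bilin_add_time]
    exact hc
  · rw [show (velocity 𝓘(ℝ, E4) γ' t) = (velocity 𝓘(ℝ, E4) γ t : E4) from hvel]; exact hne
  · show Kerr.bilin M a (γ' t : E4) (Kerr.timeVector M a (γ' t : E4)) (velocity 𝓘(ℝ, E4) γ' t) < 0
    rw [hvel, hbase, Kerr.bilin_add_time, Kerr.timeVector_add_smul_basisVector_zero]
    exact hfd

/-- **The `t*`-translate of a future timelike curve of the chart is a future timelike curve.**
[cite: ONeill1983, Ch. 9, pp. 255–256] -/
theorem isFutureTimelikeCurveOn_translate {hM : 0 ≤ M} {γ : ℝ → Kerr.region a M} {s : Set ℝ}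
    (hγ : (Kerr.smoothMetric M a M).IsFutureTimelikeCurveOn ((Kerr.timeOrientation M a M hM).ofLE le_top) γ s)
    (c : ℝ) :
    (Kerr.smoothMetric M a M).IsFutureTimelikeCurveOn ((Kerr.timeOrientation M a M hM).ofLE le_top)
      (fun t => (⟨(γ t : E4) + c • E4.basisVector 0, translate_mem_region (γ t) c⟩ : Kerr.region a M)) s := by
  intro t ht
  obtain ⟨hd, htl, -⟩ := hγ t ht
  obtain ⟨hd', hfd'⟩ := isFutureCausalCurveOn_translate hγ.isFutureCausalCurveOn c t ht
  set γ' : ℝ → Kerr.region a M := fun t => ⟨(γ t : E4) + c • E4.basisVector 0, translate_mem_region (γ t) c⟩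
  have hdE : DifferentiableAt ℝ (fun σ => (γ σ : E4)) t :=
    mdifferentiableAt_iff_differentiableAt.mp
      ((mdifferentiableAt_subtypeVal_comp_curve_iff (I := 𝓘(ℝ, E4)) (Kerr.region a M)).2 hd)
  have hvel : (velocity 𝓘(ℝ, E4) γ' t : E4) = (velocity 𝓘(ℝ, E4) γ t : E4) := by
    rw [velocity_eq_deriv, velocity_eq_deriv]
    show deriv (fun σ => (γ σ : E4) + c • E4.basisVector 0) t = deriv (fun σ => (γ σ : E4)) t
    exact deriv_add_const _
  refine ⟨hd', ?_, hfd'⟩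
  show Kerr.bilin M a (γ' t : E4) (velocity 𝓘(ℝ, E4) γ' t) (velocity 𝓘(ℝ, E4) γ' t) < 0
  rw [hvel, show (γ' t : E4) = (γ t : E4) + c • E4.basisVector 0 from rfl, Kerr.bilin_add_time]
  exact htl

/-- **Translation invariance of causal futures**: `y ∈ J⁺_K(S) ↔ y + c e₀ ∈ J⁺_K(S + c e₀)`, stated as
`J⁺` of the image of `S` under the translation. [cite: ONeill1983, Ch. 14, p. 402] -/
theorem translate_mem_JK_of_mem (hM : 0 < M) {S : Set (Kerr.region a M)} {y : Kerr.region a M}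
    (hy : y ∈ JK M a hM S) (c : ℝ) :
    (⟨(y : E4) + c • E4.basisVector 0, translate_mem_region y c⟩ : Kerr.region a M) ∈
      JK M a hM ((fun z : Kerr.region a M => (⟨(z : E4) + c • E4.basisVector 0, translate_mem_region z c⟩ :
        Kerr.region a M)) '' S) := by
  rcases hy with hy | ⟨p, hp, γ, b₀, b₁, hb, hγ, hpa, hyb⟩
  · exact Or.inl ⟨y, hy, rfl⟩
  · refine Or.inr ⟨_, ⟨p, hp, rfl⟩, _, b₀, b₁, hb, isFutureCausalCurveOn_translate hγ c, ?_, ?_⟩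
    · exact Subtype.ext (by simp [hpa])
    · exact Subtype.ext (by simp [hyb])

omit [Kerr.Facts] in
/-- Translating by `c` and then by `−c` is the identity (on points of the chart). [folklore] -/
theorem translate_translate_neg (y : Kerr.region a M) (c : ℝ) :
    (⟨((⟨(y : E4) + c • E4.basisVector 0, translate_mem_region y c⟩ : Kerr.region a M) : E4) + (-c) • E4.basisVector 0,
      translate_mem_region _ (-c)⟩ : Kerr.region a M) = y :=
  Subtype.ext (by simp [add_assoc])

/-- **`J⁺_K(S) + c e₀ = J⁺_K(S + c e₀)`**, membership form: `y + c e₀ ∈ J⁺_K(S + c e₀) ↔ y ∈ J⁺_K(S)`.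
[cite: ONeill1983, Ch. 14, p. 402] -/
theorem mem_JK_translate_iff (hM : 0 < M) {S : Set (Kerr.region a M)} (y : Kerr.region a M) (c : ℝ) :
    (⟨(y : E4) + c • E4.basisVector 0, translate_mem_region y c⟩ : Kerr.region a M) ∈
      JK M a hM ((fun z : Kerr.region a M => (⟨(z : E4) + c • E4.basisVector 0, translate_mem_region z c⟩ :
        Kerr.region a M)) '' S) ↔ y ∈ JK M a hM S := by
  refine ⟨fun h => ?_, fun h => translate_mem_JK_of_mem hM h c⟩
  have h' := translate_mem_JK_of_mem hM h (-c)
  rw [translate_translate_neg] at h'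
  convert h' using 2
  ext z
  simp only [mem_image]
  constructor
  · intro hz
    exact ⟨_, ⟨z, hz, rfl⟩, translate_translate_neg z c⟩
  · rintro ⟨_, ⟨w, hw, rfl⟩, rfl⟩
    rw [translate_translate_neg]; exact hw

omit [Kerr.Facts] in
/-- The set of `c`-translates of `S`. Membership: `z` is a translate iff `z − c e₀ ∈ S`. [folklore] -/
theorem mem_translate_image_iff {S : Set (Kerr.region a M)} {z : Kerr.region a M} {c : ℝ} :
    z ∈ ((fun w : Kerr.region a M => (⟨(w : E4) + c • E4.basisVector 0, translate_mem_region w c⟩ :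
        Kerr.region a M)) '' S) ↔
      (⟨(z : E4) + (-c) • E4.basisVector 0, translate_mem_region z (-c)⟩ : Kerr.region a M) ∈ S := by
  constructor
  · rintro ⟨w, hw, rfl⟩
    rw [translate_translate_neg]; exact hw
  · intro hz
    refine ⟨_, hz, ?_⟩
    have := translate_translate_neg z (-c)
    rw [neg_neg] at this
    exact this

/-- **Translation invariance of chronological futures**: `y + c e₀ ∈ I⁺_K(S + c e₀) ↔ y ∈ I⁺_K(S)`.
[cite: ONeill1983, Ch. 14, p. 402] -/
theorem mem_IK_translate_iff (hM : 0 < M) {S : Set (Kerr.region a M)} (y : Kerr.region a M) (c : ℝ) :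
    (⟨(y : E4) + c • E4.basisVector 0, translate_mem_region y c⟩ : Kerr.region a M) ∈
      (Kerr.spacetime M a M hM.le).metric.chronologicalFuture (Kerr.spacetime M a M hM.le).timeOrientation
        ((fun z : Kerr.region a M => (⟨(z : E4) + c • E4.basisVector 0, translate_mem_region z c⟩ :
          Kerr.region a M)) '' S) ↔
      y ∈ (Kerr.spacetime M a M hM.le).metric.chronologicalFuture (Kerr.spacetime M a M hM.le).timeOrientation S := by
  have key : ∀ (S : Set (Kerr.region a M)) (y : Kerr.region a M) (c : ℝ),
      y ∈ (Kerr.spacetime M a M hM.le).metric.chronologicalFuture (Kerr.spacetime M a M hM.le).timeOrientation S →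
      (⟨(y : E4) + c • E4.basisVector 0, translate_mem_region y c⟩ : Kerr.region a M) ∈
        (Kerr.spacetime M a M hM.le).metric.chronologicalFuture (Kerr.spacetime M a M hM.le).timeOrientation
          ((fun z : Kerr.region a M => (⟨(z : E4) + c • E4.basisVector 0, translate_mem_region z c⟩ :
            Kerr.region a M)) '' S) := by
    rintro S y c ⟨p, hp, γ, b₀, b₁, hb, hγ, hpa, hyb⟩
    refine ⟨_, ⟨p, hp, rfl⟩, _, b₀, b₁, hb, isFutureTimelikeCurveOn_translate hγ c, ?_, ?_⟩
    · exact Subtype.ext (by simp [hpa])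
    · exact Subtype.ext (by simp [hyb])
  refine ⟨fun h => ?_, key S y c⟩
  have h' := key _ _ (-c) h
  rw [translate_translate_neg] at h'
  convert h' using 2
  ext z
  constructor
  · intro hz
    exact ⟨_, ⟨z, hz, rfl⟩, translate_translate_neg z c⟩
  · rintro ⟨_, ⟨w, hw, rfl⟩, hwz⟩
    rw [← hwz]
    have : ((fun z : Kerr.region a M => (⟨(z : E4) + (-c) • E4.basisVector 0, translate_mem_region z (-c)⟩ :
        Kerr.region a M)) ((fun z : Kerr.region a M => (⟨(z : E4) + c • E4.basisVector 0,
          translate_mem_region z c⟩ : Kerr.region a M)) w)) = w := translate_translate_neg w c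
    rw [this]; exact hw

/-! ### The causal future of the slab is invariant under future `t*`-translations -/

/-- **`J⁺_K(slab) + s e₀ ⊆ J⁺_K(slab)` for `s ≥ 0`**: the translated slab `{t* = s, r ≤ 3M}` lies in the
solid cylinder, hence in `J⁺_K(slab)` (`SlabFutureContainsCylinder`, set form `hcyl`), and `J⁺ ∘ J⁺ = J⁺`.
[cite: DafermosRodnianski2008, §5.1] -/
theorem JK_slabK_translate_subset (hM : 0 < M)
    (hcyl : {y : Kerr.region a M | 0 ≤ y.1 0 ∧ Kerr.radius a y.1 ≤ 3 * M} ⊆ JK M a hM (slabK M a))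
    {s : ℝ} (hs : 0 ≤ s) {y : Kerr.region a M} (hy : y ∈ JK M a hM (slabK M a)) :
    (⟨(y : E4) + s • E4.basisVector 0, translate_mem_region y s⟩ : Kerr.region a M) ∈ JK M a hM (slabK M a) := by
  have hn2 : (2 : ℕ∞ω) ≤ ((⊤ : ℕ∞) : ℕ∞ω) := WithTop.coe_le_coe.mpr le_top
  have h1 := translate_mem_JK_of_mem hM hy s
  have hsub : ((fun z : Kerr.region a M => (⟨(z : E4) + s • E4.basisVector 0, translate_mem_region z s⟩ :
      Kerr.region a M)) '' slabK M a) ⊆ JK M a hM (slabK M a) := by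
    rintro _ ⟨z, ⟨hz0, hzr⟩, rfl⟩
    refine hcyl ⟨?_, ?_⟩
    · show 0 ≤ ((z : E4) + s • E4.basisVector 0) 0
      have hz0' : (z : E4) 0 = 0 := hz0
      simp [hz0', hs]
    · show Kerr.radius a ((z : E4) + s • E4.basisVector 0) ≤ 3 * M
      rw [Kerr.radius_add_time_smul_basisVector]; exact hzr
  have h2 := LorentzianMetric.causalFuture_mono (g := (Kerr.spacetime M a M hM.le).metric)
    (τ := (Kerr.spacetime M a M hM.le).timeOrientation) hsub h1
  rwa [show (Kerr.spacetime M a M hM.le).metric.causalFuture (Kerr.spacetime M a M hM.le).timeOrientation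
      (JK M a hM (slabK M a)) = JK M a hM (slabK M a) from
    LorentzianMetric.causalFuture_causalFuture_holds _ _ hn2 _] at h2

/-- **`W + s e₀ ⊆ W` for `s ≥ 0`**, `W = J⁺_K(slab)°`: the preimage of `W` under the translation by `−s`
is an open subset of `J⁺_K(slab)` containing `y + s e₀`. [cite: DafermosRodnianski2008, §5.1] -/
theorem interior_JK_slabK_translate_subset (hM : 0 < M)
    (hcyl : {y : Kerr.region a M | 0 ≤ y.1 0 ∧ Kerr.radius a y.1 ≤ 3 * M} ⊆ JK M a hM (slabK M a))
    {s : ℝ} (hs : 0 ≤ s) {y : Kerr.region a M} (hy : y ∈ interior (JK M a hM (slabK M a))) :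
    (⟨(y : E4) + s • E4.basisVector 0, translate_mem_region y s⟩ : Kerr.region a M) ∈
      interior (JK M a hM (slabK M a)) := by
  set T : ℝ → Kerr.region a M → Kerr.region a M := fun c z =>
    ⟨(z : E4) + c • E4.basisVector 0, translate_mem_region z c⟩ with hT
  have hTc : ∀ c, Continuous (T c) := fun c =>
    (continuous_subtype_val.add continuous_const).subtype_mk _
  have hO : IsOpen (T (-s) ⁻¹' interior (JK M a hM (slabK M a))) := isOpen_interior.preimage (hTc (-s))
  have hsub : T (-s) ⁻¹' interior (JK M a hM (slabK M a)) ⊆ JK M a hM (slabK M a) := by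
    intro z hz
    have h := JK_slabK_translate_subset hM hcyl hs (interior_subset hz)
    have : T s (T (-s) z) = z := by
      have := translate_translate_neg z (-s); rw [neg_neg] at this; exact this
    rw [← this]; exact h
  refine interior_maximal hsub hO ?_
  show T (-s) (T s y) ∈ interior (JK M a hM (slabK M a))
  rw [show T (-s) (T s y) = y from translate_translate_neg y s]; exact hy

/-- **`I⁺_K(slab) + s e₀ ⊆ I⁺_K(slab)` for `s ≥ 0`** (push-up `I⁺ ∘ J⁺ = I⁺`). [cite: DafermosRodnianski2008, §5.1] -/
theorem IK_slabK_translate_subset (hM : 0 < M)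
    (hcyl : {y : Kerr.region a M | 0 ≤ y.1 0 ∧ Kerr.radius a y.1 ≤ 3 * M} ⊆ JK M a hM (slabK M a))
    {s : ℝ} (hs : 0 ≤ s) {y : Kerr.region a M}
    (hy : y ∈ (Kerr.spacetime M a M hM.le).metric.chronologicalFuture (Kerr.spacetime M a M hM.le).timeOrientation
      (slabK M a)) :
    (⟨(y : E4) + s • E4.basisVector 0, translate_mem_region y s⟩ : Kerr.region a M) ∈
      (Kerr.spacetime M a M hM.le).metric.chronologicalFuture (Kerr.spacetime M a M hM.le).timeOrientation
        (slabK M a) := by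
  have hn1 : (1 : ℕ∞ω) ≤ ((⊤ : ℕ∞) : ℕ∞ω) := by exact_mod_cast le_top
  have h1 := (mem_IK_translate_iff hM y s).2 hy
  have hsub : ((fun z : Kerr.region a M => (⟨(z : E4) + s • E4.basisVector 0, translate_mem_region z s⟩ :
      Kerr.region a M)) '' slabK M a) ⊆ JK M a hM (slabK M a) := by
    rintro _ ⟨z, ⟨hz0, hzr⟩, rfl⟩
    refine hcyl ⟨?_, ?_⟩
    · show 0 ≤ ((z : E4) + s • E4.basisVector 0) 0
      have hz0' : (z : E4) 0 = 0 := hz0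
      simp [hz0', hs]
    · show Kerr.radius a ((z : E4) + s • E4.basisVector 0) ≤ 3 * M
      rw [Kerr.radius_add_time_smul_basisVector]; exact hzr
  have h2 := LorentzianMetric.chronologicalFuture_mono (g := (Kerr.spacetime M a M hM.le).metric)
    (τ := (Kerr.spacetime M a M hM.le).timeOrientation) hsub h1
  rwa [show (Kerr.spacetime M a M hM.le).metric.chronologicalFuture (Kerr.spacetime M a M hM.le).timeOrientation
      (JK M a hM (slabK M a)) = (Kerr.spacetime M a M hM.le).metric.chronologicalFuture
        (Kerr.spacetime M a M hM.le).timeOrientation (slabK M a) from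
    LorentzianMetric.chronologicalFuture_causalFuture_eq_of_boundaryless hn1 _] at h2

/-! ### `W` is a future set, `J⁺_K(slab)` is closed, `W ⊆ {t* > 0}` -/

/-- **`W = J⁺_K(slab)°` is a future set**: `I⁺_K(x) ⊆ W` for `x ∈ W` (indeed for `x ∈ J⁺_K(slab)`:
`I⁺(J⁺(slab)) = I⁺(slab)` is open and inside `J⁺(slab)`). [cite: ONeill1983, Ch. 14, Cor. 14.1] -/
theorem chronologicalFuture_subset_interior_JK (hM : 0 < M) {x : Kerr.region a M}
    (hx : x ∈ JK M a hM (slabK M a)) :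
    (Kerr.smoothMetric M a M).chronologicalFuture ((Kerr.timeOrientation M a M hM.le).ofLE le_top) {x} ⊆
      interior (JK M a hM (slabK M a)) := by
  have hn1 : (1 : ℕ∞ω) ≤ ((⊤ : ℕ∞) : ℕ∞ω) := by exact_mod_cast le_top
  rw [FrontierK.JK_eq] at hx ⊢
  intro y hy
  have h1 : y ∈ (Kerr.smoothMetric M a M).chronologicalFuture ((Kerr.timeOrientation M a M hM.le).ofLE le_top)
      (slabK M a) := by
    rw [← LorentzianMetric.chronologicalFuture_causalFuture_eq_of_boundaryless hn1 (slabK M a)]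
    exact LorentzianMetric.chronologicalFuture_mono (singleton_subset_iff.2 hx) hy
  exact interior_maximal
    (LorentzianMetric.chronologicalFuture_subset_causalFuture (Kerr.smoothMetric M a M)
      ((Kerr.timeOrientation M a M hM.le).ofLE le_top) (slabK M a))
    (LorentzianMetric.isOpen_chronologicalFuture_of_boundaryless _ _ _) h1

/-- **`J⁺_K(slab)` is closed** (`SlabFrontier`, set form `hfr`: its frontier lies in
`slab ∪ J⁺_K(S₃) ⊆ J⁺_K(slab)`). [cite: HawkingEllis1973CUP, §6.3, Prop. 6.3.1] -/
theorem isClosed_JK_slabK (hM : 0 < M)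
    (hfr : frontier (JK M a hM (slabK M a)) ⊆ slabK M a ∪ JK M a hM (outerSphereK M a)) :
    IsClosed (JK M a hM (slabK M a)) := by
  rw [← closure_subset_iff_isClosed, closure_eq_self_union_frontier]
  refine union_subset Subset.rfl (hfr.trans (union_subset ?_ ?_))
  · exact LorentzianMetric.subset_causalFuture (Kerr.spacetime M a M hM.le).metric _ _
  · exact LorentzianMetric.causalFuture_mono (g := (Kerr.spacetime M a M hM.le).metric) fun y hy => ⟨hy.1, hy.2.le⟩

/-- **`W ⊆ {t* > 0}`**: `J⁺_K(slab) ⊆ {t* ≥ 0}` and an interior point with `t* = 0` would have the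
translate `x − ε e₀` (`t* < 0`) in `W` for small `ε`. [cite: DafermosRodnianski2008, §5.1] -/
theorem interior_JK_slabK_pos (hM : 0 < M) (ha : |a| < M) {x : Kerr.region a M}
    (hx : x ∈ interior (JK M a hM (slabK M a))) : 0 < (x : E4) 0 := by
  have h0 : 0 ≤ (x : E4) 0 := (FrontierK.JK_slabK_subset hM ha (interior_subset hx)).1
  rcases h0.lt_or_eq with h | h
  · exact h
  · exfalso
    set T : ℝ → Kerr.region a M := fun c => ⟨(x : E4) + c • E4.basisVector 0, translate_mem_region x c⟩ with hT
    have hTc : Continuous T := ((continuous_const.add (continuous_id.smul continuous_const))).subtype_mk _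
    have hT0 : T 0 = x := Subtype.ext (by simp [hT])
    have hmem : ∀ᶠ c in 𝓝 (0 : ℝ), T c ∈ interior (JK M a hM (slabK M a)) :=
      hTc.continuousAt.preimage_mem_nhds (by rw [hT0]; exact isOpen_interior.mem_nhds hx)
    obtain ⟨ε, hε, hball⟩ := Metric.eventually_nhds_iff.1 hmem
    have hneg : T (-(ε / 2)) ∈ interior (JK M a hM (slabK M a)) :=
      hball (by rw [dist_zero_right, norm_neg, Real.norm_eq_abs, abs_of_pos (half_pos hε)]; linarith)
    have h1 := (FrontierK.JK_slabK_subset hM ha (interior_subset hneg)).1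
    have h2 : ((T (-(ε / 2)) : Kerr.region a M) : E4) 0 = (x : E4) 0 + -(ε / 2) := by simp [hT]
    rw [h2, ← h] at h1
    linarith

end FutureK

/-- **Registered bookkeeping sub-goal `stub_kerrTranslateMemRegion` of the line** (brick of the landing of
K2b-5 `stub_marchingLemma`): the `t*`-translate of a point of the Kerr star chart lies in the chart (anchor of
this file, whose content is the stationarity of the causal future of the slab:
`FutureK.isFutureCausalCurveOn_translate`, `mem_JK_translate_iff`, `JK_slabK_translate_subset`,
`interior_JK_slabK_translate_subset`, `chronologicalFuture_subset_interior_JK`, `isClosed_JK_slabK`,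
`interior_JK_slabK_pos`). [folklore] -/
theorem stub_kerrTranslateMemRegion : ∀ (M a : ℝ) (y : Kerr.region a M) (c : ℝ),
    (y : E4) + c • E4.basisVector 0 ∈ Kerr.region a M :=
  fun _ _ y c => FutureK.translate_mem_region y c

end Summit.FinalStateConjecture.FinalStateConjecture.Theorems.BondiBartnikRigidity.DirectMethod

end
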